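import Summits.AtomisticToContinuum.Crystallization.Theorems.FluxTubeKeplerFloorGivesLayered
import Summits.AtomisticToContinuum.Crystallization.Theorems.FluxTubeKeplerFluxCellKeplerSingleScale
import Summits.AtomisticToContinuum.Crystallization.Theorems.ChessboardParticlePlanesPeriodicWindowsIffCrystallization

/-!
# G20 banked candidate (published copy `Lines/G20FoundNothing_banked.lean`; NOT a registered line) — the CHEAP-FILTER ladder `CRung Θ` over `FluxTubeKepler.FloorGivesLayered`

Forward generator G1 (gen 20), seed `g1-AtomisticToContinuum-15223` =
`FluxTubeKeplerFloorGivesLayered.FloorGivesLayered_proof` (the FLOOR), crux dir `FluxCellKepler`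
(stmt-AtomisticToContinuum-15221).  OUTCOME OF THE SEAT: `found-nothing` — this file only BANKS the
best typed candidate so that it is machine-harvestable (F7); it is NOT filed as a line, because the
candidate is FLAT (provable by the floor's own counting with in-tree inputs, see §Flatness) and is the
exact dual of the registered gen-7 line `EnergyLadder.EnergyBlindRung`.

THE DIAL.  The floor: FLOOR(P₀) (`N·e(P₀) ≤ E(x)` on Lennard-Jones ground states) + BUDGET(P₀) (at every
scale `(R, η)` some `c > 0` with `c · #{(R, η)-bad sites} ≤ E(x) − N·e(P₀)` on ground states) ⇒ layered,
hence periodic, windows along every ground-state sequence.  Here the budget carries an energy CEILING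
`Θ R η : WithTop ℝ`: only the `(R, η)`-bad sites whose site-energy surplus `𝓔ⁱ(x) − 2·e(P₀)` is AT MOST
`Θ R η` are priced; energetically EXPENSIVE bad sites go free (gen 7 is the opposite filter: it frees the
CHEAP bad sites and needs local energy rigidity).  `Θ ≡ ⊤` prices every bad site: `CRung ⊤` IS the floor
(`cRung_top`, F3).  The family is monotone (`cRung_mono`: lowering the ceiling un-prices more sites, the
rung gets stronger).  Candidate rung: `CheapRung := ∀ Θ > 0 pointwise, CRung ↑Θ`.

ON PATH (F4): `Crystallization → CRung Θ` for every `Θ` (`cRung_of_crystallization`, through the landed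
`periodicWindows_of_crystallization`), hence `CheapRung_of_Crystallization`.

§Flatness (why it is not filed).  Fix `Θ R η = θ > 0`.  Along a ground-state sequence, FLOOR gives
`e(P₀) = e⋆` (`floor_iff_eq_eStar`) and `∑ᵢ (𝓔ⁱ − 2e⋆) = 2(E − N e⋆) = o(N)` (`two_mul_interactionEnergy`,
`crysEnergyLimit`).  Ground states are uniformly separated (`LennardJonesMinimalDistance_holds`), so every
site energy is `≥ −D` for a constant `D` (shell-sum packing bound, `siteEnergy_ge_nearCount`-type, in
tree for Mie potentials).  If at least `(1 − ε)N` sites had surplus `> θ`, then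
`∑ surplus ≥ N((1 − ε)θ − ε(D + 2|e⋆|)) > 0·N` for `ε < θ/(θ + D + 2|e⋆|)`, contradicting `o(N)`; so
eventually `≥ εN` sites are `θ`-cheap, of which at most `(E − N e⋆)/c = o(N)` are bad — a cheap GOOD site
exists at every scale eventually, and the floor's Steps 2–3 (`stub_layeredWindowsOfGoodSites` /
`spacing_selection`, `PeriodicGivenLayered_holds`) finish.  No new input: the one-good-site-per-scale
mechanism of the floor (G17 census item 2) is untouched.  The `Θ = 0` member is NOT flat but is implied by
gen 7's `stub_localEnergyRigidity` corner and by gen 15's surplus-only currency `CapRung 0` analysis —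
a variant, not a new lever.
-/

noncomputable section

namespace Summit.AtomisticToContinuum.Crystallization.Cruxes.FluxCellKepler.CheapLadder

open Filter Topology
open Literature.MathematicalPhysics.StatisticalMechanics
open Summit.AtomisticToContinuum.Crystallization.Theorems.FluxCellKeplerSingleScale (LayeredGood)

local notation "E3" => EuclideanSpace ℝ (Fin 3)

/-! ## The graded family -/

/-- FLOOR(P₀): `N·e(P₀) ≤ E(x)` for every Lennard-Jones ground state `x` (verbatim the first hypothesis
of `FluxTubeKepler.FloorGivesLayered`). -/
def Floor (P₀ : PeriodicConfiguration 3) : Prop :=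
  ∀ (N : ℕ) (x : Fin N → E3), IsGroundState lennardJones x →
    (N : ℝ) * P₀.energyPerParticle lennardJones ≤ interactionEnergy lennardJones x

/-- CHEAP-FILTERED BUDGET(P₀) with ceiling dial `Θ`: at scale `(R, η)` only the `(R, η)`-bad sites whose
site-energy surplus `𝓔ⁱ(x) − 2 e(P₀)` is `≤ Θ R η` (in `WithTop ℝ`) are priced. -/
def Budget (Θ : ℝ → ℝ → WithTop ℝ) (P₀ : PeriodicConfiguration 3) : Prop :=
  ∀ R η : ℝ, 0 < R → 0 < η → ∃ c : ℝ, 0 < c ∧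
    ∀ (N : ℕ) (x : Fin N → E3), IsGroundState lennardJones x →
      c * (Nat.card {i : Fin N // ¬ LayeredGood R η x i ∧
            ((siteEnergy lennardJones x i - 2 * P₀.energyPerParticle lennardJones : ℝ) :
              WithTop ℝ) ≤ Θ R η} : ℝ) ≤
        interactionEnergy lennardJones x - (N : ℝ) * P₀.energyPerParticle lennardJones

/-- Periodic windows along `x` (verbatim the conclusion of `ChessboardParticlePlanes.PeriodicWindows`). -/
def HasPeriodicWindows (x : (N : ℕ) → (Fin N → E3)) : Prop :=
  ∃ P : PeriodicConfiguration 3, ∀ R ε : ℝ, 0 < ε → ∃ᶠ N in atTop, ∃ t : E3,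
    (∀ s ∈ P.points, ‖s‖ ≤ R → ∃ i : Fin N, dist (x N i + t) s ≤ ε) ∧
    (∀ i : Fin N, ‖x N i + t‖ ≤ R → ∃ s ∈ P.points, dist (x N i + t) s ≤ ε)

/-- The graded family: FLOOR + the `Θ`-ceiling budget force periodic windows along ground states. -/
def CRung (Θ : ℝ → ℝ → WithTop ℝ) : Prop :=
  ∀ P₀ : PeriodicConfiguration 3, Floor P₀ → Budget Θ P₀ →
    ∀ x : (N : ℕ) → (Fin N → E3), (∀ N, IsGroundState lennardJones (x N)) → HasPeriodicWindows x

/-- **The banked candidate rung.** EVERY pointwise-positive real ceiling works: a certificate that never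
prices an energetically expensive defect already forces periodic windows along the ground states. -/
def CheapRung : Prop :=
  ∀ Θ : ℝ → ℝ → ℝ, (∀ R η : ℝ, 0 < R → 0 < η → 0 < Θ R η) →
    CRung (fun R η => ((Θ R η : ℝ) : WithTop ℝ))

/-! ## Dial monotonicity -/

/-- A budget pricing the larger set prices the smaller one. -/
theorem budget_anti {Θ Θ' : ℝ → ℝ → WithTop ℝ} (h : ∀ R η : ℝ, 0 < R → 0 < η → Θ R η ≤ Θ' R η)
    (P₀ : PeriodicConfiguration 3) : Budget Θ' P₀ → Budget Θ P₀ := by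
  classical
  intro hB R η hR hη
  obtain ⟨c, hc, hcB⟩ := hB R η hR hη
  refine ⟨c, hc, fun N x hx => le_trans ?_ (hcB N x hx)⟩
  have hle : Nat.card {i : Fin N // ¬ LayeredGood R η x i ∧
        ((siteEnergy lennardJones x i - 2 * P₀.energyPerParticle lennardJones : ℝ) :
          WithTop ℝ) ≤ Θ R η} ≤
      Nat.card {i : Fin N // ¬ LayeredGood R η x i ∧
        ((siteEnergy lennardJones x i - 2 * P₀.energyPerParticle lennardJones : ℝ) :
          WithTop ℝ) ≤ Θ' R η} := by
    rw [Nat.card_eq_fintype_card, Nat.card_eq_fintype_card]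
    exact Fintype.card_subtype_mono _ _ fun i hi => ⟨hi.1, hi.2.trans (h R η hR hη)⟩
  exact mul_le_mul_of_nonneg_left (by exact_mod_cast hle) hc.le

/-- `CRung` is MONOTONE in the ceiling order read downwards: lowering the ceiling strengthens the rung. -/
theorem cRung_mono {Θ Θ' : ℝ → ℝ → WithTop ℝ} (h : ∀ R η : ℝ, 0 < R → 0 < η → Θ R η ≤ Θ' R η) :
    CRung Θ → CRung Θ' :=
  fun H P₀ hF hB x hx => H P₀ hF (budget_anti h P₀ hB) x hx

/-! ## F3 — the family at `Θ = ⊤` is the proved floor -/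

/-- **F3.** `CRung ⊤` — every bad site priced — is the seed `FloorGivesLayered_proof` followed by the
proved `PeriodicGivenLayered_holds`. [folklore] -/
theorem cRung_top : CRung ⊤ := by
  intro P₀ hF hB x hx
  refine Theses.FluxTubeKepler.PeriodicGivenLayered_holds x hx
    (Theorems.FluxTubeKeplerFloorGivesLayered.FloorGivesLayered_proof P₀ hF ?_ x hx)
  intro R η hR hη
  obtain ⟨c, hc, hcB⟩ := hB R η hR hη
  refine ⟨c, hc, fun N y hy => ?_⟩
  show c * (Nat.card {i : Fin N // ¬ LayeredGood R η y i} : ℝ) ≤ _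
  simpa only [Pi.top_apply, le_top, and_true] using hcB N y hy

example : CRung ⊤ := cRung_top

/-- Every member of the family gives the floor value back. -/
theorem cRung_top_of_cRung (Θ : ℝ → ℝ → WithTop ℝ) (h : CRung Θ) : CRung ⊤ :=
  cRung_mono (fun R η _ _ => le_top) h

theorem cRung_top_of_cheapRung (h : CheapRung) : CRung ⊤ :=
  cRung_top_of_cRung _ (h (fun _ _ => 1) fun _ _ _ _ => one_pos)

/-! ## F4 — on path: `Crystallization → CRung Θ` -/

/-- ON-PATH: the sub-problem implies every member of the family (landed hull-criterion converse). -/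
theorem cRung_of_crystallization (Θ : ℝ → ℝ → WithTop ℝ) (h : _root_.Crystallization) : CRung Θ :=
  fun _ _ _ x hx =>
    Theorems.ChessboardParticlePlanesPeriodicWindowsIffCrystallization.periodicWindows_of_crystallization
      h x hx

/-- **F4 — `Crystallization → CheapRung`.** -/
@[aesop safe apply]
theorem CheapRung_of_Crystallization (h : _root_.Crystallization) : CheapRung :=
  fun Θ _ => cRung_of_crystallization _ h

end Summit.AtomisticToContinuum.Crystallization.Cruxes.FluxCellKepler.CheapLadder
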